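import Summits.RiemannHypothesis.RiemannHypothesis.Theorems.PfPersistenceDefectiveTransportConvex
import Summits.RiemannHypothesis.RiemannHypothesis.Theorems.SoloInformedGroundStateDecay2
import HarnessLib

/-!
# The COARSE transport: fixed-step speed limits, floors, and what the Dini form adds
# (leaf G1.22 TRANSPORT, part 6)

pub-rhpf cell (mechanism/rigidity campaign; **no RH claims**), seat `pub-rhpf-transport-1` gen 6.
Companion of parts 4 (`…AnyBase`) and 5 (`…Convex`).

Write `ε = weilGroundEnergy` (the bottom of Weil's quadratic functional on the window `[-a, a]`).
Parts 1–5 transported the bottom with the LOWER-RIGHT-DINI clause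
`ε x − ε (x + h) ≤ h (K ε x + C e^{δx} + η)` for arbitrarily SMALL `h` (a Grönwall fence), and left
two links of the exponent ladder of TRANSPORT.md §14 open: "any a-priori speed limit at all
(`θ_S < ∞`)" and "RH ⟹ speed limit".  This file observes that for everything the ladder says about
ZEROS the small steps are unnecessary.  Call *coarse speed limit at rate `δ` with constant `C`, step
`s > 0`, from `b`* the fixed-step statement `∀ x ≥ b, ε x − ε (x + s) ≤ C e^{δx}` (no `η`, no small
`h`, no `K`).

1. **Telescoping replaces Grönwall** (`floor_of_coarseSpeedLimit`): a coarse speed limit at ONE step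
   `s` from `b > 0` gives the eventual floor `ε a ≥ −C' e^{δa}` (`a ≥ b`) — sum the geometric series
   along `b, b+s, b+2s, …` and use antitonicity of `ε` inside each step — hence (Solo's exact
   thermometer) `|Re ρ − 1/2| ≤ δ/2` and `QuasiRiemannHypothesis (1/2 + δ/2)`
   (`strip_half_of_coarseSpeedLimit`, `quasiRiemannHypothesis_of_coarseSpeedLimit`).
2. **The converse is free** (`coarseSpeedLimit_of_floor`): a floor at rate `δ` from `b > 0` gives the
   coarse speed limit at the SAME rate at EVERY step (`ε x ≤ ε b`, `−ε (x+s) ≤ C' e^{δs} e^{δx}`).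
   So, RH-free and with no shape hypothesis, COARSE SPEED LIMIT ⟺ FLOOR at every rate: the ladder
   collapse that part 5 obtained for the Dini form only under CONVEXITY holds unconditionally in the
   coarse form (`θ_S^coarse = θ_D`).
3. **Consequences.** (a) `coarseSpeedLimit_unconditional`, `coarseSpeedLimit_of_one_lt`: the coarse
   speed limit holds RH-FREE at every rate `κ > 1`, from every base, at every step (Solo's
   unconditional floor `ε a ≥ −C(1+a)e^{a}`) — an a-priori speed limit DOES exist in the coarse sense
   (`θ_S^coarse ≤ 1`).  (b) `coarseSpeed_le_of_riemannHypothesis`,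
   `riemannHypothesis_iff_coarseSubexpSpeed`: RH ⟹ the coarse descent over any step is at most `ε b`
   (rate `0`; indeed doubly-exponentially small, `coarseSpeed_exp_exp_of_riemannHypothesis`), and
   RH ⟺ coarse speed limits at every rate `δ > 0` — BOTH directions elementary, with no appeal to
   `WindowLipschitz` (contrast part 2, where RH ⟹ K-clause needs the 50-file local-Lipschitz theorem,
   and RH ⟹ Dini speed limit is not known at all).  (c) `coarseSpeedLimit_of_defectiveLeakage`,
   `coarseSpeedLimit_of_speedLimit`: every Dini-form member of parts 1–5 implies the coarse one.
4. **What the Dini form adds, exactly** (`speedLimit_iff_coarseSpeedLimit_allSteps`): the Dini speed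
   limit at rate `δ` with constant `C` from `b` holds IFF the coarse speed limit holds at EVERY step
   `s > 0` with the constant `(C/δ)(e^{δs} − 1)` — a constant VANISHING LINEARLY as `s → 0`.  A floor
   gives every step too, but with a constant `max (ε b) 0 + C' e^{δs}` that does not vanish.  The
   residual "no cliffs" is therefore precisely a weighted UNIFORM one-sided Lipschitz statement —
   growth `O(e^{δA})` of the local one-sided Lipschitz constant of `ε` on `[A, A+1]` (which
   `WindowLipschitz` gives only existentially per compact range) — and NO dictionary between that
   growth and the zeros of `ζ` is known in either direction: every zero statement of the T-D family
   (strip `δ/2`, quasi-RH, the all-rates ⟺ RH calibration, the Ω-forms) is already carried by the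
   coarse form.  (Ω-forms: `coarseSpeedLimit_fails_of_offline_zero`,
   `exists_rate_of_not_riemannHypothesis_coarse`.)

Nothing here is a statement about `ζ` beyond the tree's theorems it composes; every member is a
typed HYPOTHESIS or an unconditional elementary bound.  References: E. Bombieri, *Remarks on Weil's
quadratic functional in the theory of prime numbers I*, Rend. Mat. Acc. Lincei (9) 11 (2000)
183–233, §4 (the functional; the a-priori bound behind Solo's floor); H. Yoshida, *On Hermitian forms
attached to zeta functions*, Adv. Stud. Pure Math. 21 (1992) 281–325 (the window criterion);
A. Connes, C. Consani, H. Moscovici, arXiv:2511.22755, Cor. 3.7–3.8 (monotonicity of the bottom).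
[folklore]
-/

noncomputable section

set_option linter.dupNamespace false  -- D-0017 nested layout: `RiemannHypothesis.RiemannHypothesis`

namespace Summit.RiemannHypothesis.RiemannHypothesis.Theorems.PfPersistenceDefectiveTransport

open Set
open _root_.Literature.NumberTheory.LFunctions
open _root_.Summit.RiemannHypothesis.RiemannHypothesis.Theorems.WeilWindowFlowWindowLipschitz
  (windowLipschitz_antitone)

/-! ## 1. Real analysis: telescoping a fixed-step descent bound -/

/-- **Discrete Grönwall by telescoping.**  If `f x − f (x + s) ≤ C e^{δx}` for all `x ≥ b`
(`s > 0`, `δ > 0`), then along the lattice `b + n s` one has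
`f b − (C e^{δb}/(e^{δs} − 1)) (e^{δsn} − 1) ≤ f (b + n s)` (geometric series). [folklore] -/
theorem sub_geom_le_of_coarse {f : ℝ → ℝ} {b C δ s : ℝ} (hδ : 0 < δ) (hs : 0 < s)
    (h : ∀ x : ℝ, b ≤ x → f x - f (x + s) ≤ C * Real.exp (δ * x)) (n : ℕ) :
    f b - C * Real.exp (δ * b) / (Real.exp (δ * s) - 1) * (Real.exp (δ * s * n) - 1) ≤
      f (b + n * s) := by
  have hq : 0 < Real.exp (δ * s) - 1 := by
    have : 1 < Real.exp (δ * s) := Real.one_lt_exp_iff.2 (by positivity)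
    linarith
  have hMq : C * Real.exp (δ * b) / (Real.exp (δ * s) - 1) * (Real.exp (δ * s) - 1) =
      C * Real.exp (δ * b) := div_mul_cancel₀ _ hq.ne'
  induction n with
  | zero => simp
  | succ n ih =>
    have hstep := h (b + n * s) (by nlinarith [hs.le, (n.cast_nonneg : (0 : ℝ) ≤ n)])
    have e1 : b + n * s + s = b + ((n + 1 : ℕ) : ℝ) * s := by push_cast; ring
    rw [e1] at hstep
    have e2 : Real.exp (δ * (b + n * s)) = Real.exp (δ * b) * Real.exp (δ * s * n) := by
      rw [← Real.exp_add]; ring_nf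
    rw [e2] at hstep
    have e3 : Real.exp (δ * s * ((n + 1 : ℕ) : ℝ)) = Real.exp (δ * s * n) * Real.exp (δ * s) := by
      rw [← Real.exp_add]; push_cast; ring_nf
    rw [e3]
    have key : C * Real.exp (δ * b) / (Real.exp (δ * s) - 1) *
        (Real.exp (δ * s * n) * Real.exp (δ * s) - 1) =
        C * Real.exp (δ * b) / (Real.exp (δ * s) - 1) * (Real.exp (δ * s * n) - 1) +
          C * Real.exp (δ * b) / (Real.exp (δ * s) - 1) * (Real.exp (δ * s) - 1) *
            Real.exp (δ * s * n) := by ring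
    rw [hMq] at key
    linarith

/-! ## 2. Coarse speed limit ⟹ floor ⟹ strip (telescoping replaces the Grönwall fence) -/

/-- **Coarse speed limit at ONE step ⟹ eventual floor at the same rate.**  If for some step `s > 0`
and all `x ≥ b` (`b > 0`) the Weil bottom satisfies `ε x − ε (x + s) ≤ C e^{δx}` (`C ≥ 0`, `δ > 0`), then
`−C' e^{δa} ≤ ε a` for all `a ≥ b`, with `C' = |ε b| + C e^{δs}/(e^{δs} − 1)`.  No small steps, no
`η`, no seed, no sign condition on `ε b`.  CONDITIONAL; RH-free; no RH claim. [folklore] -/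
theorem floor_of_coarseSpeedLimit {b C δ s : ℝ} (hb : 0 < b) (hC : 0 ≤ C) (hδ : 0 < δ) (hs : 0 < s)
    (h : ∀ x : ℝ, b ≤ x → weilGroundEnergy x - weilGroundEnergy (x + s) ≤ C * Real.exp (δ * x)) :
    ∃ C' : ℝ, 0 ≤ C' ∧ ∀ a : ℝ, b ≤ a → -(C' * Real.exp (δ * a)) ≤ weilGroundEnergy a := by
  have hq : 0 < Real.exp (δ * s) - 1 := by
    have : 1 < Real.exp (δ * s) := Real.one_lt_exp_iff.2 (by positivity)
    linarith
  refine ⟨|weilGroundEnergy b| + C * Real.exp (δ * s) / (Real.exp (δ * s) - 1),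
    by positivity, fun a hba ↦ ?_⟩
  -- the lattice point just above `a`
  set n : ℕ := ⌈(a - b) / s⌉₊ with hn
  have hn1 : (a - b) / s ≤ n := Nat.le_ceil _
  have hn2 : (n : ℝ) < (a - b) / s + 1 := Nat.ceil_lt_add_one (div_nonneg (by linarith) hs.le)
  have ha1 : a ≤ b + n * s := by
    have := mul_le_mul_of_nonneg_right hn1 hs.le
    rw [div_mul_cancel₀ _ hs.ne'] at this
    linarith
  have ha2 : (n : ℝ) * s ≤ a - b + s := by
    have := mul_le_mul_of_nonneg_right hn2.le hs.le
    rw [add_mul, div_mul_cancel₀ _ hs.ne', one_mul] at this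
    linarith
  -- antitone inside the last step, then the telescoped bound
  have hanti : weilGroundEnergy (b + n * s) ≤ weilGroundEnergy a :=
    windowLipschitz_antitone (hb.trans_le hba) ha1
  have htel := sub_geom_le_of_coarse (f := weilGroundEnergy) hδ hs h n
  -- bound the geometric factor: `e^{δ s n} ≤ e^{δ (a - b + s)}`
  have hM : 0 ≤ C * Real.exp (δ * b) / (Real.exp (δ * s) - 1) := by positivity
  have hE : Real.exp (δ * s * n) ≤ Real.exp (δ * (a - b + s)) :=
    Real.exp_le_exp.2 (by nlinarith)
  have h1 : C * Real.exp (δ * b) / (Real.exp (δ * s) - 1) * (Real.exp (δ * s * n) - 1) ≤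
      C * Real.exp (δ * b) / (Real.exp (δ * s) - 1) * Real.exp (δ * (a - b + s)) := by
    have := mul_le_mul_of_nonneg_left hE hM
    nlinarith
  have h2 : C * Real.exp (δ * b) / (Real.exp (δ * s) - 1) * Real.exp (δ * (a - b + s)) =
      C * Real.exp (δ * s) / (Real.exp (δ * s) - 1) * Real.exp (δ * a) := by
    rw [div_mul_eq_mul_div, div_mul_eq_mul_div, mul_assoc, ← Real.exp_add, mul_assoc,
      ← Real.exp_add]
    ring_nf
  have hea : 1 ≤ Real.exp (δ * a) := Real.one_le_exp (by nlinarith)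
  have h3 : -|weilGroundEnergy b| ≤ weilGroundEnergy b := neg_abs_le _
  have h4 : |weilGroundEnergy b| ≤ |weilGroundEnergy b| * Real.exp (δ * a) :=
    le_mul_of_one_le_right (abs_nonneg _) hea
  nlinarith

/-- **Coarse speed limit ⟹ zero-free strip of half the rate** (Solo's exact thermometer
`abs_re_sub_half_le_of_weilGroundEnergy_exp_lower`; eventual floors suffice).  Vacuous for `δ ≥ 1`.
CONDITIONAL; RH-free; no RH claim. [folklore] -/
theorem strip_half_of_coarseSpeedLimit {b C δ s : ℝ} (hb : 0 < b) (hC : 0 ≤ C) (hδ : 0 < δ)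
    (hs : 0 < s)
    (h : ∀ x : ℝ, b ≤ x → weilGroundEnergy x - weilGroundEnergy (x + s) ≤ C * Real.exp (δ * x))
    {ρ : ℂ} (hρ : ρ ∈ ZetaZeros.riemannZetaNontrivialZeros) : |ρ.re - 1 / 2| ≤ δ / 2 := by
  obtain ⟨C', _, hC'⟩ := floor_of_coarseSpeedLimit hb hC hδ hs h
  exact abs_re_sub_half_le_of_weilGroundEnergy_exp_lower (κ := δ) (C := C') (a₀ := b) hδ.le hC' hρ

/-- **Coarse speed limit ⟹ `QuasiRiemannHypothesis (1/2 + δ/2)`.**  CONDITIONAL; RH-free; no RH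
claim. [folklore] -/
theorem quasiRiemannHypothesis_of_coarseSpeedLimit {b C δ s : ℝ} (hb : 0 < b) (hC : 0 ≤ C)
    (hδ : 0 < δ) (hs : 0 < s)
    (h : ∀ x : ℝ, b ≤ x → weilGroundEnergy x - weilGroundEnergy (x + s) ≤ C * Real.exp (δ * x)) :
    QuasiRiemannHypothesis (1 / 2 + δ / 2) := by
  intro z hz h0 h1
  have hmem : z ∈ ZetaZeros.riemannZetaNontrivialZeros :=
    ZetaZeros.riemannZetaNontrivialZeros.mem_iff'.2 ⟨hz, by linarith, h1⟩
  have h2 := strip_half_of_coarseSpeedLimit hb hC hδ hs h hmem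
  rw [abs_le] at h2
  linarith [h2.2]

/-! ## 3. Floor ⟹ coarse speed limit at EVERY step (the converse is free) -/

/-- **Floor ⟹ coarse speed limit at the same rate, at every step.**  If `−C e^{δa} ≤ ε a` for all
`a ≥ b` (`b > 0`, `δ ≥ 0`; no sign condition on `C`), then for every step `s ≥ 0` and every `x ≥ b`:
`ε x − ε (x + s) ≤ (max (ε b) 0 + max C 0 · e^{δs}) e^{δx}` (`ε x ≤ ε b` by antitonicity,
`−ε (x+s) ≤ C e^{δ(x+s)}`).  RH-free; no RH claim. [folklore] -/
theorem coarseSpeedLimit_of_floor {b C δ : ℝ} (hb : 0 < b) (hδ : 0 ≤ δ)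
    (hfloor : ∀ a : ℝ, b ≤ a → -(C * Real.exp (δ * a)) ≤ weilGroundEnergy a) {s : ℝ} (hs : 0 ≤ s) :
    ∀ x : ℝ, b ≤ x → weilGroundEnergy x - weilGroundEnergy (x + s) ≤
      (max (weilGroundEnergy b) 0 + max C 0 * Real.exp (δ * s)) * Real.exp (δ * x) := by
  intro x hx
  have h1 : weilGroundEnergy x ≤ weilGroundEnergy b := windowLipschitz_antitone hb hx
  have h2 := hfloor (x + s) (by linarith)
  have hex : 1 ≤ Real.exp (δ * x) := Real.one_le_exp (by nlinarith)
  have hsplit : Real.exp (δ * (x + s)) = Real.exp (δ * s) * Real.exp (δ * x) := by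
    rw [← Real.exp_add]; ring_nf
  rw [hsplit] at h2
  have h3 : weilGroundEnergy b ≤ max (weilGroundEnergy b) 0 := le_max_left _ _
  have h4 : max (weilGroundEnergy b) 0 ≤ max (weilGroundEnergy b) 0 * Real.exp (δ * x) :=
    le_mul_of_one_le_right (le_max_right _ _) hex
  have h5 : C * (Real.exp (δ * s) * Real.exp (δ * x)) ≤
      max C 0 * (Real.exp (δ * s) * Real.exp (δ * x)) :=
    mul_le_mul_of_nonneg_right (le_max_left _ _) (by positivity)
  nlinarith

/-- **Coarse speed limit ⟺ floor (same rate, RH-free, no shape hypothesis).**  For `b > 0`, `δ > 0`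
and any step `s > 0`: (∃ `C ≥ 0`, coarse speed limit at rate `δ`, step `s`, from `b`) ⟺
(∃ `C' ≥ 0`, floor `−C' e^{δa} ≤ ε a` for `a ≥ b`).  The ladder collapse `θ_S = θ_D` that part 5 proved
for the Dini form under convexity holds unconditionally in the coarse form.  RH-free; no RH claim.
[folklore] -/
theorem coarseSpeedLimit_iff_floor {b δ s : ℝ} (hb : 0 < b) (hδ : 0 < δ) (hs : 0 < s) :
    (∃ C : ℝ, 0 ≤ C ∧ ∀ x : ℝ, b ≤ x →
        weilGroundEnergy x - weilGroundEnergy (x + s) ≤ C * Real.exp (δ * x)) ↔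
    (∃ C' : ℝ, 0 ≤ C' ∧ ∀ a : ℝ, b ≤ a → -(C' * Real.exp (δ * a)) ≤ weilGroundEnergy a) := by
  constructor
  · rintro ⟨C, hC, h⟩
    exact floor_of_coarseSpeedLimit hb hC hδ hs h
  · rintro ⟨C', hC', h⟩
    exact ⟨max (weilGroundEnergy b) 0 + max C' 0 * Real.exp (δ * s), by positivity,
      coarseSpeedLimit_of_floor hb hδ.le h hs.le⟩

/-! ## 4. Unconditional coarse speed limits (an a-priori speed limit exists in the coarse sense) -/

/-- **Unconditional coarse speed limit** (explicit form): there is `C ≥ 0` such that for every base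
`b > 0`, every step `s ≥ 0` and every `x ≥ b`: `ε x − ε (x + s) ≤ ε b + C (1 + (x + s)) e^{x+s}`
(antitonicity and Solo's unconditional floor `weilGroundEnergy_ge_neg_exp`).  RH-free; no RH claim.
[folklore] -/
theorem coarseSpeedLimit_unconditional :
    ∃ C : ℝ, 0 ≤ C ∧ ∀ b : ℝ, 0 < b → ∀ s : ℝ, 0 ≤ s → ∀ x : ℝ, b ≤ x →
      weilGroundEnergy x - weilGroundEnergy (x + s) ≤
        weilGroundEnergy b + C * (1 + (x + s)) * Real.exp (x + s) := by
  obtain ⟨C, hC0, hC⟩ := weilGroundEnergy_ge_neg_exp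
  refine ⟨C, hC0, fun b hb s hs x hx ↦ ?_⟩
  have h1 : weilGroundEnergy x ≤ weilGroundEnergy b := windowLipschitz_antitone hb hx
  have h2 := hC (x + s) (by linarith)
  linarith

/-- **The coarse speed limit holds RH-FREE at every rate `κ > 1`**, from every base `b > 0`, at every
step `s ≥ 0` (Solo's `weilGroundEnergy_exp_lower_of_one_lt` + `coarseSpeedLimit_of_floor`): in the
coarse sense `θ_S ≤ 1` is PROVED, while the Dini-form question of TRANSPORT.md §14 stays open.
RH-free; no RH claim. [folklore] -/
theorem coarseSpeedLimit_of_one_lt {κ : ℝ} (hκ : 1 < κ) {b : ℝ} (hb : 0 < b) {s : ℝ} (hs : 0 ≤ s) :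
    ∃ C : ℝ, 0 ≤ C ∧ ∀ x : ℝ, b ≤ x →
      weilGroundEnergy x - weilGroundEnergy (x + s) ≤ C * Real.exp (κ * x) := by
  obtain ⟨C, hC⟩ := weilGroundEnergy_exp_lower_of_one_lt hκ
  exact ⟨max (weilGroundEnergy b) 0 + max C 0 * Real.exp (κ * s), by positivity,
    coarseSpeedLimit_of_floor hb (by linarith) (fun a hba ↦ hC a (hb.trans_le hba)) hs⟩

/-! ## 5. RH calibration in the coarse form — both directions elementary, no `WindowLipschitz` -/

/-- **RH ⟹ the coarse descent is bounded by `ε b` (rate `0`).**  Under RH `ε ≥ 0`, so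
`ε x − ε (x + s) ≤ ε x ≤ ε b` for `x ≥ b > 0`, `s ≥ 0`.  CONDITIONAL on RH; proof.conditional; credits
nothing; no RH claim. [folklore] -/
theorem coarseSpeed_le_of_riemannHypothesis (hRH : _root_.RiemannHypothesis) {b : ℝ} (hb : 0 < b)
    {s : ℝ} (hs : 0 ≤ s) :
    ∀ x : ℝ, b ≤ x → weilGroundEnergy x - weilGroundEnergy (x + s) ≤ weilGroundEnergy b := by
  intro x hx
  have h1 : weilGroundEnergy x ≤ weilGroundEnergy b := windowLipschitz_antitone hb hx
  have h2 : 0 ≤ weilGroundEnergy (x + s) :=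
    weilGroundEnergy_nonneg_of_riemannHypothesis hRH (by linarith)
  linarith

/-- **RH ⟹ the coarse descent is doubly-exponentially small**: `ε x − ε (x + s) ≤ C exp (−c e^{2x})`
for `x ≥ 1`, `s ≥ 0` (RH gives `ε (x+s) ≥ 0`; the tree's UNCONDITIONAL decay
`weilGroundEnergy_exp_exp_decay` bounds `ε x`).  CONDITIONAL on RH; credits nothing; no RH claim.
[folklore] -/
theorem coarseSpeed_exp_exp_of_riemannHypothesis (hRH : _root_.RiemannHypothesis) :
    ∃ c : ℝ, 0 < c ∧ ∃ C : ℝ, ∀ x : ℝ, 1 ≤ x → ∀ s : ℝ, 0 ≤ s →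
      weilGroundEnergy x - weilGroundEnergy (x + s) ≤ C * Real.exp (-c * Real.exp (2 * x)) := by
  obtain ⟨c, hc, C, hC⟩ := weilGroundEnergy_exp_exp_decay
  refine ⟨c, hc, C, fun x hx s hs ↦ ?_⟩
  have h2 : 0 ≤ weilGroundEnergy (x + s) :=
    weilGroundEnergy_nonneg_of_riemannHypothesis hRH (by linarith)
  linarith [hC x hx]

/-- **RH ⟺ coarse speed limits at every rate** (the coarse form of the T-D calibration):
RH holds iff for every rate `δ > 0` there are a base `b > 0`, a step `s > 0` and a constant `C ≥ 0`
with `ε x − ε (x + s) ≤ C e^{δx}` for all `x ≥ b`.  (`→`: rate `0` suffices, `C = max (ε 1) 0`;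
`←`: telescoping ⟹ floors at every rate ⟹ Solo's `riemannHypothesis_of_weilGroundEnergy_subexp`.)
Contrast part 2 (RH ⟹ K-clause needs `WindowLipschitz`) and part 4 (RH ⟹ Dini speed limit: not
known).  proof.conditional both ways; credits nothing; no RH claim. [folklore] -/
theorem riemannHypothesis_iff_coarseSubexpSpeed :
    _root_.RiemannHypothesis ↔
      ∀ δ : ℝ, 0 < δ → ∃ b s C : ℝ, 0 < b ∧ 0 < s ∧ 0 ≤ C ∧ ∀ x : ℝ, b ≤ x →
        weilGroundEnergy x - weilGroundEnergy (x + s) ≤ C * Real.exp (δ * x) := by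
  constructor
  · intro hRH δ hδ
    refine ⟨1, 1, max (weilGroundEnergy 1) 0, one_pos, one_pos, le_max_right _ _, fun x hx ↦ ?_⟩
    have h1 := coarseSpeed_le_of_riemannHypothesis hRH one_pos zero_le_one x hx
    have hex : 1 ≤ Real.exp (δ * x) := Real.one_le_exp (by nlinarith)
    have h2 : max (weilGroundEnergy 1) 0 ≤ max (weilGroundEnergy 1) 0 * Real.exp (δ * x) :=
      le_mul_of_one_le_right (le_max_right _ _) hex
    linarith [le_max_left (weilGroundEnergy 1) 0]
  · intro H
    refine riemannHypothesis_of_weilGroundEnergy_subexp fun κ hκ ↦ ?_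
    obtain ⟨b, s, C, hb, hs, hC, h⟩ := H κ hκ
    obtain ⟨C', _, hC'⟩ := floor_of_coarseSpeedLimit hb hC hκ hs h
    exact ⟨C', b, hC'⟩

/-! ## 6. Every Dini-form member implies the coarse one; what the Dini form adds, exactly -/

/-- **K-clause (defective Dini leakage, parts 1/4) ⟹ coarse speed limit** at the same rate, every step
(through part 4's floor).  RH-free; no RH claim. [folklore] -/
theorem coarseSpeedLimit_of_defectiveLeakage {b C δ : ℝ} (hb : 0 < b) (hC : 0 ≤ C) (hδ : 0 < δ)
    (h : ∀ A : ℝ, b ≤ A → ∃ K : ℝ, 0 ≤ K ∧ ∀ x ∈ Ico b A, ∀ η δ' : ℝ, 0 < η → 0 < δ' →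
      ∃ h : ℝ, 0 < h ∧ h < δ' ∧
        weilGroundEnergy x - weilGroundEnergy (x + h) ≤
          h * (K * weilGroundEnergy x + C * Real.exp (δ * x) + η)) {s : ℝ} (hs : 0 ≤ s) :
    ∃ C₁ : ℝ, 0 ≤ C₁ ∧ ∀ x : ℝ, b ≤ x →
      weilGroundEnergy x - weilGroundEnergy (x + s) ≤ C₁ * Real.exp (δ * x) := by
  obtain ⟨C', hC', hfloor⟩ := floor_of_defectiveLeakage hb hC hδ h
  exact ⟨max (weilGroundEnergy b) 0 + max C' 0 * Real.exp (δ * s), by positivity,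
    coarseSpeedLimit_of_floor hb hδ.le hfloor hs⟩

/-- **Dini speed limit ⟹ coarse speed limit with a constant vanishing linearly in the step**:
from `b > 0` at rate `δ` with constant `C`, for every step `s ≥ 0` and `x ≥ b`,
`ε x − ε (x + s) ≤ (C/δ)(e^{δs} − 1) e^{δx}` (part 4's monotone additive gauge).  RH-free; no RH
claim. [folklore] -/
theorem coarseSpeedLimit_of_speedLimit {b C δ : ℝ} (hb : 0 < b) (hC : 0 ≤ C) (hδ : 0 < δ)
    (h : ∀ x : ℝ, b ≤ x → ∀ η δ' : ℝ, 0 < η → 0 < δ' →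
      ∃ h : ℝ, 0 < h ∧ h < δ' ∧
        weilGroundEnergy x - weilGroundEnergy (x + h) ≤ h * (C * Real.exp (δ * x) + η))
    {s : ℝ} (hs : 0 ≤ s) :
    ∀ x : ℝ, b ≤ x → weilGroundEnergy x - weilGroundEnergy (x + s) ≤
      C / δ * (Real.exp (δ * s) - 1) * Real.exp (δ * x) := by
  intro x hx
  have hm := monotoneOn_addGauge_of_speedLimit hb hC hδ h (show x ∈ Ici b from hx)
    (show x + s ∈ Ici b from le_trans hx (by linarith)) (by linarith : x ≤ x + s)
  simp only at hm
  have hsplit : Real.exp (δ * (x + s)) = Real.exp (δ * s) * Real.exp (δ * x) := by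
    rw [← Real.exp_add]; ring_nf
  rw [hsplit] at hm
  nlinarith

/-- **What the Dini form adds, exactly.**  For `b > 0`, `C ≥ 0`, `δ > 0`: the Dini speed limit at rate
`δ` with constant `C` from `b` holds IFF the coarse speed limit holds from `b` at EVERY step `s > 0` with
the constant `(C/δ)(e^{δs} − 1)` — i.e. with a constant that VANISHES LINEARLY as `s → 0` (both sides
are equivalent to monotonicity of the additive gauge `a ↦ ε a + (C/δ)e^{δa}` on `[b, ∞)`, part 4).
A floor gives every step as well (`coarseSpeedLimit_of_floor`) but with the non-vanishing constant
`max (ε b) 0 + C' e^{δs}`; the residual "no cliffs" is exactly this linear modulus, a weighted uniform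
one-sided Lipschitz statement about `ε` with no known zero content.  RH-free; no RH claim. [folklore] -/
theorem speedLimit_iff_coarseSpeedLimit_allSteps {b C δ : ℝ} (hb : 0 < b) (hC : 0 ≤ C) (hδ : 0 < δ) :
    (∀ x : ℝ, b ≤ x → ∀ η δ' : ℝ, 0 < η → 0 < δ' →
      ∃ h : ℝ, 0 < h ∧ h < δ' ∧
        weilGroundEnergy x - weilGroundEnergy (x + h) ≤ h * (C * Real.exp (δ * x) + η)) ↔
    (∀ s : ℝ, 0 < s → ∀ x : ℝ, b ≤ x → weilGroundEnergy x - weilGroundEnergy (x + s) ≤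
      C / δ * (Real.exp (δ * s) - 1) * Real.exp (δ * x)) := by
  constructor
  · intro h s hs
    exact coarseSpeedLimit_of_speedLimit hb hC hδ h hs.le
  · intro H
    refine speedLimit_of_monotoneOn_addGauge hC hδ ?_
    intro x hx y _ hxy
    rcases hxy.eq_or_lt with rfl | hlt
    · exact le_rfl
    have h1 := H (y - x) (by linarith) x hx
    have e1 : x + (y - x) = y := by ring
    rw [e1] at h1
    have hsplit : Real.exp (δ * y) = Real.exp (δ * (y - x)) * Real.exp (δ * x) := by
      rw [← Real.exp_add]; ring_nf
    show weilGroundEnergy x + C / δ * Real.exp (δ * x) ≤ weilGroundEnergy y + C / δ * Real.exp (δ * y)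
    rw [hsplit]
    nlinarith

/-! ## 7. Ω-forms in the coarse form -/

/-- **A zero at offset `> δ/2` defeats the coarse speed limit at rate `δ`** from EVERY base, at EVERY
step, with EVERY constant.  CONDITIONAL on the zero; RH-free; no RH claim. [folklore] -/
theorem coarseSpeedLimit_fails_of_offline_zero {ρ₀ : ℂ}
    (hρ₀ : ρ₀ ∈ ZetaZeros.riemannZetaNontrivialZeros) {δ : ℝ} (hδ : 0 < δ)
    (hoff : δ / 2 < |ρ₀.re - 1 / 2|) {b C s : ℝ} (hb : 0 < b) (hC : 0 ≤ C) (hs : 0 < s) :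
    ¬ (∀ x : ℝ, b ≤ x → weilGroundEnergy x - weilGroundEnergy (x + s) ≤ C * Real.exp (δ * x)) :=
  fun h ↦ absurd (strip_half_of_coarseSpeedLimit hb hC hδ hs h hρ₀) (not_le.2 hoff)

/-- **Off RH some rate admits no coarse speed limit at all**: if RH fails there is `δ > 0` such that
for every base `b > 0`, step `s > 0` and constant `C ≥ 0` the bound `ε x − ε (x + s) ≤ C e^{δx}` fails
for some `x ≥ b`.  No RH claim. [folklore] -/
theorem exists_rate_of_not_riemannHypothesis_coarse (hRH : ¬ _root_.RiemannHypothesis) :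
    ∃ δ : ℝ, 0 < δ ∧ ∀ b s C : ℝ, 0 < b → 0 < s → 0 ≤ C →
      ¬ (∀ x : ℝ, b ≤ x →
        weilGroundEnergy x - weilGroundEnergy (x + s) ≤ C * Real.exp (δ * x)) := by
  by_contra H
  push Not at H
  refine hRH (riemannHypothesis_iff_coarseSubexpSpeed.2 fun δ hδ ↦ ?_)
  obtain ⟨b, s, C, hb, hs, hC, h⟩ := H δ hδ
  exact ⟨b, s, C, hb, hs, hC, h⟩

end Summit.RiemannHypothesis.RiemannHypothesis.Theorems.PfPersistenceDefectiveTransport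

end
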